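import Summits.AtomisticToContinuum.FouriersLaw.Theorems.OddSectorIrreversibilityWitnessGlueCore

/-!
# `WitnessGlue` (stmt-AtomisticToContinuum-15160) — tap-leak block estimate (file 1/2)

Route `OddSectorIrreversibility` (sub `FouriersLaw`), crux `WitnessGlue`, rev-17 body
`TapLeakBound → ConeScaleCorrector → SubBallisticWindow → BoundedResponse`, line `p-rate-central-block`:
ONE central block `[N/4, N-1-N/4)`, ONE window `τ = a(N/4)/2`, the landed aligned Cauchy–Schwarz
witness `OddSectorWitness.witness_inequality`, with the E3-shaped leak step of the landed
`OddSectorWitness.response_bound` replaced by the P-shaped `leak_bound_of_tapLeak`: the tap-leak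
budget `P` bounds the pairing `|T ∫ ∂_b u⁺ · ∂_b (j_i∘Φ_s) dμ_T| ≤ C'/(1 + (d - s/a))^{3/2}`, which
through the leak identity `CorrectorTheory` A(7) gives a constant-rate leak allowance
`⟨u⁻, j_i∘Φ_t⟩ ≥ ⟨u⁻, j_i⟩ - (2γC'/(1 + q/2)^{3/2}) t` on the central block (`0 < t ≤ a q/2`).
`core_ineq` is the exponent identity at the marginal order 3/2,
`(q/2) √((N-1)T²D + 1) ≤ (1 + q/2)^{3/2} (4T√D + √2/2)` (`q ≥ 4`, `N ≤ 8q`), and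
`response_bound_of_tapLeak` the one-`N` bound `0 ≤ D ≤ 2(K₁ + aγC√2/2)/T² + (4aγCT)²/T⁴`,
`K₁ = 64√(C₁C₂(1+a))/a` (`N ≥ 16`). The `∀ N` wrapper `witnessGlue_proof : WitnessGlue` is file 2/2
(`…WitnessGlueTapLeakGlue.lean`); no route statement is asserted here. References: Kundu–Dhar–Narayan
2009 (open-chain Green–Kubo); Lepri–Livi–Politi 2003 (finite-time Green–Kubo cut-off); folklore.
Candidate proof by the crux-ideate planner seat (idea `p-rate-central-block`), landed by the line lead.
-/

noncomputable section

namespace Summit.AtomisticToContinuum.FouriersLaw.Theorems.OddSectorWitness.TapLeak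

open MeasureTheory Filter Topology ProbabilityTheory Set
open scoped NNReal ENNReal
open Literature.MathematicalPhysics.KineticTheory.HeatConduction
open Summit.AtomisticToContinuum.FouriersLaw.Theorems.ClosedConeSensitivity.Negative.ZeroFrictionDictionary
open Summit.AtomisticToContinuum.FouriersLaw.Theorems.OddSectorWitness

variable {ω₂ lam β : ℝ}

/-! ## 1. The P-shaped leak bound (FIRST LEMMA, proved) -/

/-- **Leak bound from the tap-leak budget `P`.** For a bond `i` at distance `≥ q` from both
contacts, the leak identity A(7) of `CorrectorTheory` (hypothesis `hA7`, verbatim the landed shape)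
and the tap-leak budget `P = TapLeakBound` instantiated at this `N`, `i`, `u` and both contacts
(hypothesis `hP`, verbatim the route decl's consequent with `C' = C √((|∫ u J dμ_T| + Z) Z)`) give,
for `0 < t ≤ a q / 2`, the constant-rate lower bound
`⟨u⁻, j_i∘Φ_t⟩_{μ_T} ≥ ⟨u⁻, j_i⟩_{μ_T} - (2 γ C' / (1 + q/2)^{3/2}) t`.
Junk-safe: no integrability of anything is assumed. [folklore] -/
theorem leak_bound_of_tapLeak (γ : ℝ) (N : ℕ) {T : ℝ} (hT : 0 < T) (hγ : 0 ≤ γ)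
    {a C' : ℝ} (ha : 0 < a) (hC' : 0 ≤ C')
    {u : PhaseSpace N → ℝ}
    (b₀ b₁ : Fin N) (hb₀ : b₀.val = 0) (hb₁ : b₁.val = N - 1)
    (i : Fin N) {q : ℕ} (hqi : q ≤ i.val) (hqi' : q ≤ N - 2 - i.val)
    (jt : ℝ → PhaseSpace N → ℝ)
    (hA7 : ∀ t : ℝ, 0 ≤ t →
      (∫ x, (u x - u (x.1, -x.2)) / 2 * jt t x ∂(gibbsWeight ω₂ lam β γ N T)) -
        (∫ x, (u x - u (x.1, -x.2)) / 2 * (pinnedChain ω₂ lam β γ).bondCurrent N i x ∂(gibbsWeight ω₂ lam β γ N T)) =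
      -(γ * T) * ∫ s in Ioc (0 : ℝ) t,
        ((∫ x, partialP b₀ (fun y : PhaseSpace N => (u y + u (y.1, -y.2)) / 2) x * partialP b₀ (jt s) x
            ∂(gibbsWeight ω₂ lam β γ N T)) +
          ∫ x, partialP b₁ (fun y : PhaseSpace N => (u y + u (y.1, -y.2)) / 2) x * partialP b₁ (jt s) x
            ∂(gibbsWeight ω₂ lam β γ N T)))
    (hP : ∀ b : Fin N, (b.val = 0 ∨ b.val = N - 1) → ∀ s : ℝ, 0 ≤ s →
      s ≤ a * ((if b.val = 0 then i.val else N - 2 - i.val : ℕ) : ℝ) →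
      |T * ∫ x, partialP b (fun y : PhaseSpace N => (u y + u (y.1, -y.2)) / 2) x * partialP b (jt s) x
          ∂(gibbsWeight ω₂ lam β γ N T)| ≤
        C' / (1 + ((((if b.val = 0 then i.val else N - 2 - i.val : ℕ) : ℝ)) - s / a)) ^ (3 / 2 : ℝ))
    {t : ℝ} (ht : 0 < t) (htq : t ≤ a * q / 2)
    (hjtt : ∀ x, jt t x = (pinnedChain ω₂ lam β γ).bondCurrent N i (detFlow ω₂ lam β N t x)) :
    ∫ x, (u x - u (x.1, -x.2)) / 2 * (pinnedChain ω₂ lam β γ).bondCurrent N i x ∂(gibbsWeight ω₂ lam β γ N T) -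
      (2 * γ * C' / (1 + (q : ℝ) / 2) ^ (3 / 2 : ℝ)) * t ≤
    ∫ x, (u x - u (x.1, -x.2)) / 2 * (pinnedChain ω₂ lam β γ).bondCurrent N i (detFlow ω₂ lam β N t x)
      ∂(gibbsWeight ω₂ lam β γ N T) := by
  set P := pinnedChain ω₂ lam β γ
  set μ := gibbsWeight ω₂ lam β γ N T
  set ue : PhaseSpace N → ℝ := fun y => (u y + u (y.1, -y.2)) / 2 with hue
  set ρ : ℝ := (1 + (q : ℝ) / 2) ^ (3 / 2 : ℝ) with hρ
  have hq0 : (0 : ℝ) ≤ q := Nat.cast_nonneg q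
  have hρ0 : 0 < ρ := Real.rpow_pos_of_pos (by positivity) _
  -- distances of the bond to the two contacts are at least `q`
  have hdist : ∀ b : Fin N, (b.val = 0 ∨ b.val = N - 1) →
      (q : ℝ) ≤ ((if b.val = 0 then i.val else N - 2 - i.val : ℕ) : ℝ) := by
    intro b hb
    split_ifs
    · exact_mod_cast hqi
    · exact_mod_cast hqi'
  -- each tap's leak integrand at time `s ∈ (0, t]` is bounded by `C' / (T ρ)`
  have hLb : ∀ b : Fin N, (b.val = 0 ∨ b.val = N - 1) → ∀ s ∈ Ioc (0 : ℝ) t,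
      |∫ x, partialP b ue x * partialP b (jt s) x ∂μ| ≤ C' / (T * ρ) := by
    intro b hb s hs
    set d : ℕ := (if b.val = 0 then i.val else N - 2 - i.val) with hd
    have hqd : (q : ℝ) ≤ d := hdist b hb
    have hs0 : 0 ≤ s := hs.1.le
    have hsq : s / a ≤ q / 2 := by
      rw [div_le_iff₀ ha]; nlinarith [hs.2, htq]
    have hsd : s ≤ a * (d : ℝ) := by
      have h1 : s ≤ a * q / 2 := hs.2.trans htq
      nlinarith [hqd, ha.le, hq0]
    have hPb := hP b hb s hs0 hsd
    -- the tail factor is monotone in the depth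
    have hbase : 1 + (q : ℝ) / 2 ≤ 1 + ((d : ℝ) - s / a) := by linarith
    have hρle : ρ ≤ (1 + ((d : ℝ) - s / a)) ^ (3 / 2 : ℝ) :=
      Real.rpow_le_rpow (by positivity) hbase (by norm_num)
    have hfrac : C' / (1 + ((d : ℝ) - s / a)) ^ (3 / 2 : ℝ) ≤ C' / ρ :=
      div_le_div_of_nonneg_left hC' hρ0 hρle
    have habsT : |T * ∫ x, partialP b ue x * partialP b (jt s) x ∂μ| ≤ C' / ρ := hPb.trans hfrac
    rw [abs_mul, abs_of_pos hT] at habsT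
    rw [le_div_iff₀ (mul_pos hT hρ0)]
    have := mul_le_mul_of_nonneg_right habsT hρ0.le
    rw [div_mul_cancel₀ _ hρ0.ne'] at this
    nlinarith [this, abs_nonneg (∫ x, partialP b ue x * partialP b (jt s) x ∂μ)]
  -- the sum of the two taps
  set M : ℝ := 2 * C' / (T * ρ) with hM
  have hsum : ∀ s ∈ Ioc (0 : ℝ) t,
      ‖(∫ x, partialP b₀ ue x * partialP b₀ (jt s) x ∂μ) + ∫ x, partialP b₁ ue x * partialP b₁ (jt s) x ∂μ‖ ≤ M := by
    intro s hs
    have h0 := hLb b₀ (Or.inl hb₀) s hs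
    have h1 := hLb b₁ (Or.inr hb₁) s hs
    rw [Real.norm_eq_abs]
    refine (abs_add_le _ _).trans ((add_le_add h0 h1).trans (le_of_eq ?_))
    rw [hM]; ring
  -- the time integral of the leak
  have hI : ‖∫ s in Ioc (0 : ℝ) t, ((∫ x, partialP b₀ ue x * partialP b₀ (jt s) x ∂μ) +
      ∫ x, partialP b₁ ue x * partialP b₁ (jt s) x ∂μ)‖ ≤ M * t := by
    have h := norm_setIntegral_le_of_norm_le_const (μ := (volume : Measure ℝ)) (s := Ioc (0 : ℝ) t)
      (by rw [Real.volume_Ioc]; exact ENNReal.ofReal_lt_top) hsum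
    rwa [Measure.real, Real.volume_Ioc, sub_zero, ENNReal.toReal_ofReal ht.le] at h
  -- conclude from the leak identity
  have hA := hA7 t ht.le
  simp only [hjtt] at hA
  rw [Real.norm_eq_abs] at hI
  have hγT : 0 ≤ γ * T := mul_nonneg hγ hT.le
  have habs := abs_le.1 hI
  have hMt : γ * T * (M * t) = 2 * γ * C' / ρ * t := by
    rw [hM]; field_simp
  nlinarith [habs.1, habs.2, hγT, hMt]

/-! ## 2. The exponent identity at order 3/2 (proved) -/

/-- `√(x + 1) ≤ √x + 1` for `x ≥ 0`. [folklore] -/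
theorem sqrt_add_one_le {x : ℝ} (hx : 0 ≤ x) : Real.sqrt (x + 1) ≤ Real.sqrt x + 1 := by
  have h0 := Real.sqrt_nonneg x
  calc Real.sqrt (x + 1) ≤ Real.sqrt ((Real.sqrt x + 1) ^ 2) :=
        Real.sqrt_le_sqrt (by nlinarith [Real.sq_sqrt hx, h0])
    _ = Real.sqrt x + 1 := Real.sqrt_sq (by positivity)

/-- **Core inequality (the marginal order 3/2 closes on one central block).** For `q ≥ 4`,
`N ≤ 8 q`, `D ≥ 0`, `T > 0`:
`(q/2) √((N-1) T² D + 1) ≤ (1 + q/2)^{3/2} (4 T √D + √2/2)`.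
Reading: leak rate `∝ √((N-1)T²D+1) · q^{-3/2}` (tap budget × tail at depth `q`) times window
`∝ q` is `O(√D + 1)`, uniformly in `N`: `q · q^{-3/2} · √N ≤ √8`. [folklore] -/
theorem core_ineq {q N D T : ℝ} (hq : 4 ≤ q) (hN : N ≤ 8 * q) (hD : 0 ≤ D) (hT : 0 < T) :
    q / 2 * Real.sqrt ((N - 1) * T ^ 2 * D + 1) ≤
      (1 + q / 2) ^ (3 / 2 : ℝ) * (4 * T * Real.sqrt D + Real.sqrt 2 / 2) := by
  have hq2 : 0 < q / 2 := by linarith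
  have hsD := Real.sqrt_nonneg D
  have hs2 : Real.sqrt 2 ^ 2 = 2 := Real.sq_sqrt (by norm_num)
  have hs2pos : 0 < Real.sqrt 2 := Real.sqrt_pos.2 (by norm_num)
  -- lower bound for the tail factor: `(1 + q/2)^{3/2} ≥ (q/2) √(q/2)`
  have hρ : q / 2 * Real.sqrt (q / 2) ≤ (1 + q / 2) ^ (3 / 2 : ℝ) := by
    -- `x^{3/2} = x √x` (cf. `Literature.NumberTheory.LFunctions.VK.rpow_three_halves_eq`)
    have h32 : (q / 2) ^ (3 / 2 : ℝ) = q / 2 * Real.sqrt (q / 2) := by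
      rw [show (3 / 2 : ℝ) = 1 + 1 / 2 by norm_num, Real.rpow_add' hq2.le (by norm_num), Real.rpow_one,
        Real.sqrt_eq_rpow]
    rw [← h32]
    exact Real.rpow_le_rpow hq2.le (by linarith) (by norm_num)
  -- upper bound for the budget factor: `√((N-1)T²D + 1) ≤ T √(8 q) √D + 1`
  have hbud : Real.sqrt ((N - 1) * T ^ 2 * D + 1) ≤ T * Real.sqrt (8 * q) * Real.sqrt D + 1 := by
    have hx : 0 ≤ T ^ 2 * (8 * q) * D := by positivity
    have h1 : Real.sqrt ((N - 1) * T ^ 2 * D + 1) ≤ Real.sqrt (T ^ 2 * (8 * q) * D + 1) := by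
      refine Real.sqrt_le_sqrt ?_
      nlinarith [mul_nonneg (sq_nonneg T) hD]
    have h2 := sqrt_add_one_le hx
    have h3 : Real.sqrt (T ^ 2 * (8 * q) * D) = T * Real.sqrt (8 * q) * Real.sqrt D := by
      rw [Real.sqrt_mul (by positivity), Real.sqrt_mul (by positivity), Real.sqrt_sq hT.le]
    linarith [h1, h2, h3.le, h3.ge]
  -- `√(8q) = 4 √(q/2)` and `1 ≤ (√2/2)·√(q/2)·… `: assemble
  have h8 : Real.sqrt (8 * q) = 4 * Real.sqrt (q / 2) := by
    rw [show 8 * q = 4 ^ 2 * (q / 2) by ring, Real.sqrt_mul (by positivity), Real.sqrt_sq (by norm_num)]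
  have hsq : Real.sqrt 2 ≤ Real.sqrt (q / 2) := Real.sqrt_le_sqrt (by linarith)
  have hsq2 : 0 ≤ Real.sqrt (q / 2) := Real.sqrt_nonneg _
  -- target: (q/2) √(...) ≤ (q/2)√(q/2) (4T√D + √2/2) ≤ (1+q/2)^{3/2} (4T√D + √2/2)
  have hmid : q / 2 * Real.sqrt ((N - 1) * T ^ 2 * D + 1) ≤
      q / 2 * Real.sqrt (q / 2) * (4 * T * Real.sqrt D + Real.sqrt 2 / 2) := by
    have h1 : Real.sqrt ((N - 1) * T ^ 2 * D + 1) ≤ Real.sqrt (q / 2) * (4 * T * Real.sqrt D + Real.sqrt 2 / 2) := by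
      rw [h8] at hbud
      -- `1 ≤ √(q/2) · √2/2` since `√(q/2) ≥ √2`
      have hone : 1 ≤ Real.sqrt (q / 2) * (Real.sqrt 2 / 2) := by nlinarith [hsq, hs2, hs2pos]
      nlinarith [hbud, hone, mul_nonneg hsq2 (mul_nonneg (mul_nonneg (by norm_num : (0:ℝ) ≤ 4) hT.le) hsD)]
    have := mul_le_mul_of_nonneg_left h1 hq2.le
    linarith [this]
  have hfac : 0 ≤ 4 * T * Real.sqrt D + Real.sqrt 2 / 2 := by positivity
  exact hmid.trans (mul_le_mul_of_nonneg_right hρ hfac)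

/-! ## 3. The response bound at one chain length from (P, E1, E2) (proved) -/

/-- **The response bound at one chain length `N ≥ 16` from the tap-leak budget.** Dictionary
form of the route's hypotheses at that `N`: the corrector `u ∈ L²(μ_T)` with clauses A(5) (bond
sum rule), A(6) (tap energy identity), A(7) (leak identity vs the closed flow, through the
zero-friction dictionary `hjt`), the Green–Kubo pairing `⟨u, J⟩_{μ_T} = Z (N-1) T² D` (conjunct B
with A(4)), `E1`, `E2` at this `N`, and the tap-leak budget `P` at this `N` and `u` (`hP`, the
route decl's consequent verbatim). Then `0 ≤ D ≤ 2(K₁ + aγC√2/2)/T² + (4aγCT)²/T⁴`,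
`K₁ = 64 √(C₁C₂(1+a))/a`, uniformly in `N` (one central block `[N/4, N-1-N/4)`, one window
`τ = a (N/4)/2`). Compared with the landed E3-based `OddSectorWitness.response_bound`: no `C¹`
hypothesis on `u`, no `L²`-membership or symmetry of the tap derivatives (`hsym`), no junk case.
[folklore] -/
theorem response_bound_of_tapLeak (hω : 0 < ω₂) (hl : 0 ≤ lam) (hβ : 0 ≤ β) (γ : ℝ) (N : ℕ) {T : ℝ}
    (hT : 0 < T) (hγ : 0 < γ)
    {a C C₁ C₂ : ℝ} (ha : 0 < a) (hC : 0 ≤ C) (hC₁ : 0 ≤ C₁) (hC₂ : 0 ≤ C₂)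
    (hN : 16 ≤ N) {D : ℝ}
    {u : PhaseSpace N → ℝ} (hu2 : MemLp u 2 (gibbsWeight ω₂ lam β γ N T))
    (h5 : ∀ i i' : Fin N, i'.val = i.val + 1 → i'.val + 1 < N →
      ∫ x, u x * (pinnedChain ω₂ lam β γ).bondCurrent N i x ∂(gibbsWeight ω₂ lam β γ N T) =
        ∫ x, u x * (pinnedChain ω₂ lam β γ).bondCurrent N i' x ∂(gibbsWeight ω₂ lam β γ N T))
    (b₀ b₁ : Fin N) (hb₀ : b₀.val = 0) (hb₁ : b₁.val = N - 1)
    (h6 : γ * T * ((∫ x, (partialP b₀ u x) ^ 2 ∂(gibbsWeight ω₂ lam β γ N T)) +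
        ∫ x, (partialP b₁ u x) ^ 2 ∂(gibbsWeight ω₂ lam β γ N T)) =
      ∫ x, u x * (∑ i : Fin N, (pinnedChain ω₂ lam β γ).bondCurrent N i x) ∂(gibbsWeight ω₂ lam β γ N T))
    (jt : Fin N → ℝ → PhaseSpace N → ℝ)
    (hjt : ∀ i s x, jt i s x = (pinnedChain ω₂ lam β γ).bondCurrent N i (detFlow ω₂ lam β N ((s.toNNReal : ℝ≥0) : ℝ) x))
    (hA7 : ∀ (i : Fin N) (t : ℝ), 0 ≤ t →
      (∫ x, (u x - u (x.1, -x.2)) / 2 * jt i t x ∂(gibbsWeight ω₂ lam β γ N T)) -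
        (∫ x, (u x - u (x.1, -x.2)) / 2 * (pinnedChain ω₂ lam β γ).bondCurrent N i x ∂(gibbsWeight ω₂ lam β γ N T)) =
      -(γ * T) * ∫ s in Ioc (0 : ℝ) t,
        ((∫ x, partialP b₀ (fun y : PhaseSpace N => (u y + u (y.1, -y.2)) / 2) x * partialP b₀ (jt i s) x
            ∂(gibbsWeight ω₂ lam β γ N T)) +
          ∫ x, partialP b₁ (fun y : PhaseSpace N => (u y + u (y.1, -y.2)) / 2) x * partialP b₁ (jt i s) x
            ∂(gibbsWeight ω₂ lam β γ N T)))
    (hP : ∀ (i b : Fin N), (b.val = 0 ∨ b.val = N - 1) → ∀ s : ℝ, 0 ≤ s →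
      s ≤ a * ((if b.val = 0 then i.val else N - 2 - i.val : ℕ) : ℝ) →
      |T * ∫ x, partialP b (fun y : PhaseSpace N => (u y + u (y.1, -y.2)) / 2) x * partialP b (jt i s) x
          ∂(gibbsWeight ω₂ lam β γ N T)| ≤
        C * Real.sqrt ((|∫ x, u x * (∑ k : Fin N, (pinnedChain ω₂ lam β γ).bondCurrent N k x) ∂(gibbsWeight ω₂ lam β γ N T)| +
            ∫ x, Real.exp (-((pinnedChain ω₂ lam β γ).hamiltonian N x) / T) ∂volume) *
          ∫ x, Real.exp (-((pinnedChain ω₂ lam β γ).hamiltonian N x) / T) ∂volume) /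
        (1 + ((((if b.val = 0 then i.val else N - 2 - i.val : ℕ) : ℝ)) - s / a)) ^ (3 / 2 : ℝ))
    (hGK : ∫ x, u x * (∑ i : Fin N, (pinnedChain ω₂ lam β γ).bondCurrent N i x) ∂(gibbsWeight ω₂ lam β γ N T) =
      (∫ x, Real.exp (-((pinnedChain ω₂ lam β γ).hamiltonian N x) / T) ∂volume) * (((N : ℝ) - 1) * T ^ 2 * D))
    (hE1 : ∫ x, (u x) ^ 2 ∂(gibbsWeight ω₂ lam β γ N T) ≤
      C₁ * (N : ℝ) ^ 2 * ∫ x, Real.exp (-((pinnedChain ω₂ lam β γ).hamiltonian N x) / T) ∂volume)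
    (hE2 : ∀ k₁ k₂ : ℕ, k₁ ≤ k₂ → k₂ + 1 ≤ N → ∀ τ : ℝ, 0 ≤ τ →
      ∫ x, (window ω₂ lam β γ N k₁ k₂ τ x) ^ 2 ∂(gibbsWeight ω₂ lam β γ N T) ≤
        C₂ * (1 + τ) * ((k₂ : ℝ) - k₁) * ∫ x, Real.exp (-((pinnedChain ω₂ lam β γ).hamiltonian N x) / T) ∂volume) :
    0 ≤ D ∧ D ≤ 2 * (64 * Real.sqrt (C₁ * C₂ * (1 + a)) / a + a * γ * C * Real.sqrt 2 / 2) / T ^ 2 +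
      (4 * a * γ * C * T) ^ 2 / T ^ 4 := by
  set P := pinnedChain ω₂ lam β γ
  set μ := gibbsWeight ω₂ lam β γ N T
  set Z : ℝ := ∫ x, Real.exp (-(P.hamiltonian N x) / T) ∂volume with hZdef
  set K₁ : ℝ := 64 * Real.sqrt (C₁ * C₂ * (1 + a)) / a with hK₁
  set c₄ : ℝ := 4 * a * γ * C * T with hc₄
  set c₅ : ℝ := a * γ * C * Real.sqrt 2 / 2 with hc₅
  have hZ : 0 < Z := integral_exp_pos (pinnedChain_integrable_gibbsDensity hω hl hβ γ N hT)
  have hN2 : (2 : ℝ) ≤ N := by exact_mod_cast (show 2 ≤ N by omega)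
  have hN1 : 0 < (N : ℝ) - 1 := by linarith
  have hK₁0 : 0 ≤ K₁ := by positivity
  have hc₄0 : 0 ≤ c₄ := by positivity
  have hc₅0 : 0 ≤ c₅ := by positivity
  -- Step A: `D ≥ 0` from the tap identity (junk-safe: both integrals of squares are `≥ 0`)
  have hΛ'0 : 0 ≤ (∫ x, (partialP b₀ u x) ^ 2 ∂μ) + ∫ x, (partialP b₁ u x) ^ 2 ∂μ :=
    add_nonneg (integral_nonneg fun _ => sq_nonneg _) (integral_nonneg fun _ => sq_nonneg _)
  have hGK' : γ * T * ((∫ x, (partialP b₀ u x) ^ 2 ∂μ) + ∫ x, (partialP b₁ u x) ^ 2 ∂μ) =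
      Z * (((N : ℝ) - 1) * T ^ 2 * D) := h6.trans hGK
  have hD0 : 0 ≤ D := by
    have h1 : 0 ≤ Z * (((N : ℝ) - 1) * T ^ 2 * D) := by
      rw [← hGK']; exact mul_nonneg (mul_nonneg hγ.le hT.le) hΛ'0
    have h2 : 0 < Z * (((N : ℝ) - 1) * T ^ 2) := by positivity
    rw [show Z * (((N : ℝ) - 1) * T ^ 2 * D) = (Z * (((N : ℝ) - 1) * T ^ 2)) * D by ring] at h1
    exact nonneg_of_mul_nonneg_right h1 h2
  refine ⟨hD0, ?_⟩
  -- the block, the window, the static pairing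
  set q : ℕ := N / 4 with hq
  have hq4 : 4 * q ≤ N := Nat.mul_div_le N 4
  have hqlt : N < 4 * q + 4 := by omega
  have hq1 : 4 ≤ q := by omega
  set k₂ : ℕ := N - 1 - q with hk₂def
  have hk : q ≤ k₂ := by omega
  have hk₂ : k₂ + 1 ≤ N := by omega
  set τ : ℝ := a * q / 2 with hτ
  have hτ0 : 0 < τ := by positivity
  set s : ℝ := Z * T ^ 2 * D with hs
  have hS : ∀ i : Fin N, q ≤ i.val → i.val < k₂ → ∫ x, u x * P.bondCurrent N i x ∂μ = s := by
    intro i _ hi2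
    refine integral_mul_bondCurrent_eq_of_sumRule hω hl hβ γ N hT hu2 h5 ?_ i (by omega)
    rw [hGK]; ring
  -- the tap-leak budget's constant at this `N`: `C' = C √((|⟨u,J⟩| + Z) Z) = C Z √((N-1)T²D + 1)`
  set C' : ℝ := C * Real.sqrt ((|∫ x, u x * (∑ k : Fin N, P.bondCurrent N k x) ∂μ| + Z) * Z) with hC'def
  have hC'0 : 0 ≤ C' := by positivity
  have hC'eq : C' = C * Z * Real.sqrt (((N : ℝ) - 1) * T ^ 2 * D + 1) := by
    have habs : |∫ x, u x * (∑ k : Fin N, P.bondCurrent N k x) ∂μ| = Z * (((N : ℝ) - 1) * T ^ 2 * D) := by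
      rw [hGK]; exact abs_of_nonneg (by positivity)
    rw [hC'def, habs, show (Z * (((N : ℝ) - 1) * T ^ 2 * D) + Z) * Z = Z ^ 2 * (((N : ℝ) - 1) * T ^ 2 * D + 1) by ring,
      Real.sqrt_mul (sq_nonneg Z), Real.sqrt_sq hZ.le]
    ring
  set ρ : ℝ := (1 + (q : ℝ) / 2) ^ (3 / 2 : ℝ) with hρdef
  have hρ0 : 0 < ρ := Real.rpow_pos_of_pos (by positivity) _
  set L : ℝ := 2 * γ * C' / ρ with hL
  have hL0 : 0 ≤ L := by positivity
  -- the constant-rate leak on the block, from `P` through A(7)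
  have hLeak : ∀ i : Fin N, q ≤ i.val → i.val < k₂ → ∀ t : ℝ, 0 < t → t ≤ τ →
      ∫ x, (u x - u (x.1, -x.2)) / 2 * P.bondCurrent N i x ∂μ - L * t ≤
        ∫ x, (u x - u (x.1, -x.2)) / 2 * P.bondCurrent N i (detFlow ω₂ lam β N t x) ∂μ := by
    intro i hi1 hi2 t ht htτ
    have hjtt : ∀ x, jt i t x = P.bondCurrent N i (detFlow ω₂ lam β N t x) := fun x => by
      rw [hjt, Real.coe_toNNReal _ ht.le]
    exact leak_bound_of_tapLeak γ N hT hγ.le ha hC'0 b₀ b₁ hb₀ hb₁ i hi1 (by omega) (jt i) (hA7 i)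
      (hP i) ht (by rw [hτ] at htτ; exact htτ) hjtt
  have hW := witness_inequality hω hl hβ γ N hT hu2 hk (by omega) hτ0.le hS hLeak
  -- real-arithmetic facts about the block and the window (as in the landed core)
  set Br : ℝ := (k₂ : ℝ) - q with hBrdef
  have hqr4 : (4 : ℝ) ≤ q := by exact_mod_cast hq1
  have hq4r : 4 * (q : ℝ) ≤ N := by exact_mod_cast hq4
  have hqN : (N : ℝ) ≤ 8 * q := by
    have : (N : ℝ) < 4 * q + 4 := by exact_mod_cast hqlt
    linarith
  have hBr_eq : Br = (N : ℝ) - 1 - 2 * q := by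
    rw [hBrdef, hk₂def, Nat.cast_sub (by omega), Nat.cast_sub (by omega), Nat.cast_one]
    ring
  have hN16 : (16 : ℝ) ≤ N := by exact_mod_cast hN
  have hBr : (N : ℝ) / 4 ≤ Br := by rw [hBr_eq]; linarith only [hq4r, hN16]
  have hBr' : Br ≤ N := by rw [hBr_eq]; linarith only [hqr4]
  have hBr0 : 0 < Br := by linarith only [hBr, hN2]
  have hτN : τ ≤ a * N := by
    rw [hτ, show a * (q : ℝ) / 2 = a * (q / 2) by ring]
    exact mul_le_mul_of_nonneg_left (by linarith only [hq4r, hqr4]) ha.le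
  have hBrτ : a * (N : ℝ) ^ 2 / 64 ≤ Br * τ := by
    rw [hτ]
    have : a * (N : ℝ) ^ 2 / 64 ≤ ((N : ℝ) / 4) * (a * q / 2) := by
      rw [show a * (N : ℝ) ^ 2 / 64 = (a * N / 8) * (N / 8) by ring,
        show ((N : ℝ) / 4) * (a * q / 2) = (a * N / 8) * q by ring]
      exact mul_le_mul_of_nonneg_left (by linarith only [hqN]) (by positivity)
    exact this.trans (mul_le_mul_of_nonneg_right hBr (by positivity))
  -- `E1`, `E2` ⇒ the Cauchy–Schwarz right-hand side is `≤ Z N² √(C₁C₂(1+a))`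
  set K : ℝ := C₁ * C₂ * (1 + a) with hKdef
  have hK0 : 0 ≤ K := by positivity
  have hE2' := hE2 q k₂ hk hk₂ τ hτ0.le
  have hR : Real.sqrt (∫ x, (u x) ^ 2 ∂μ) * Real.sqrt (∫ x, (window ω₂ lam β γ N q k₂ τ x) ^ 2 ∂μ) ≤
      Z * (N : ℝ) ^ 2 * Real.sqrt K := by
    have h1 := Real.sqrt_le_sqrt hE1
    have h2 := Real.sqrt_le_sqrt hE2'
    have h12 := mul_le_mul h1 h2 (Real.sqrt_nonneg _) (Real.sqrt_nonneg _)
    refine h12.trans ?_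
    rw [← Real.sqrt_mul (by positivity)]
    have hprod : (1 + τ) * Br ≤ (1 + a) * (N : ℝ) ^ 2 := by
      have h1N : (1 : ℝ) ≤ N := by linarith only [hN2]
      have : 1 + τ ≤ (1 + a) * N := by
        rw [show (1 + a) * (N : ℝ) = N + a * N by ring]; linarith only [hτN, h1N]
      calc (1 + τ) * Br ≤ ((1 + a) * N) * N := mul_le_mul this hBr' hBr0.le (by positivity)
        _ = (1 + a) * (N : ℝ) ^ 2 := by ring
    have hle : C₁ * (N : ℝ) ^ 2 * Z * (C₂ * (1 + τ) * Br * Z) ≤ (Z * (N : ℝ) ^ 2 * Real.sqrt K) ^ 2 := by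
      calc C₁ * (N : ℝ) ^ 2 * Z * (C₂ * (1 + τ) * Br * Z) = (C₁ * C₂ * Z ^ 2 * (N : ℝ) ^ 2) * ((1 + τ) * Br) := by ring
        _ ≤ (C₁ * C₂ * Z ^ 2 * (N : ℝ) ^ 2) * ((1 + a) * (N : ℝ) ^ 2) :=
            mul_le_mul_of_nonneg_left hprod (by positivity)
        _ = (Z * (N : ℝ) ^ 2 * Real.sqrt K) ^ 2 := by
            rw [mul_pow, mul_pow, Real.sq_sqrt hK0, hKdef]; ring
    calc Real.sqrt (C₁ * (N : ℝ) ^ 2 * Z * (C₂ * (1 + τ) * Br * Z)) ≤ Real.sqrt ((Z * (N : ℝ) ^ 2 * Real.sqrt K) ^ 2) :=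
          Real.sqrt_le_sqrt hle
      _ = Z * (N : ℝ) ^ 2 * Real.sqrt K := Real.sqrt_sq (by positivity)
  -- (I): the witness inequality with `E1`, `E2`
  have hI : Br * Z * τ * (T ^ 2 * D) ≤ Z * (N : ℝ) ^ 2 * Real.sqrt K + Br * τ ^ 2 / 2 * L := by
    have h1 : Br * (s * τ - L * τ ^ 2 / 2) ≤ Z * (N : ℝ) ^ 2 * Real.sqrt K := hW.trans hR
    rw [hs] at h1
    linarith only [h1]
  -- (II): the two comparison facts
  have hA : Z * (N : ℝ) ^ 2 * Real.sqrt K ≤ Br * Z * τ * K₁ := by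
    rw [hK₁]
    have : (N : ℝ) ^ 2 ≤ Br * τ * (64 / a) := by
      rw [mul_div_assoc', le_div_iff₀ ha]; linarith only [hBrτ]
    calc Z * (N : ℝ) ^ 2 * Real.sqrt K ≤ Z * (Br * τ * (64 / a)) * Real.sqrt K := by gcongr
      _ = Br * Z * τ * (64 * Real.sqrt K / a) := by ring
  have hB : Br * τ ^ 2 / 2 * L ≤ Br * Z * τ * (c₄ * Real.sqrt D + c₅) := by
    -- the heart of the order-3/2 bookkeeping: `(τ/2) L ≤ Z (c₄ √D + c₅)` by `core_ineq`
    have hcore := core_ineq (q := (q : ℝ)) (N := (N : ℝ)) hqr4 hqN hD0 hT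
    have hhalf : τ / 2 * L ≤ Z * (c₄ * Real.sqrt D + c₅) := by
      rw [hL, hC'eq, hτ, hc₄, hc₅]
      have hfac : 0 ≤ a * γ * C * Z := by
        have := hγ.le; positivity
      -- `(a q/2)/2 · (2 γ (C Z √(…)) / ρ) = a γ C Z · ((q/2) √(…) / ρ)`
      have heq : a * ↑q / 2 / 2 * (2 * γ * (C * Z * Real.sqrt ((↑N - 1) * T ^ 2 * D + 1)) / ρ) =
          (a * γ * C * Z) * ((↑q / 2 * Real.sqrt ((↑N - 1) * T ^ 2 * D + 1)) / ρ) := by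
        field_simp
      have hdiv : (↑q / 2 * Real.sqrt ((↑N - 1) * T ^ 2 * D + 1)) / ρ ≤ 4 * T * Real.sqrt D + Real.sqrt 2 / 2 := by
        rw [div_le_iff₀ hρ0]
        rw [hρdef]
        linarith [hcore]
      rw [heq]
      calc (a * γ * C * Z) * ((↑q / 2 * Real.sqrt ((↑N - 1) * T ^ 2 * D + 1)) / ρ)
          ≤ (a * γ * C * Z) * (4 * T * Real.sqrt D + Real.sqrt 2 / 2) :=
            mul_le_mul_of_nonneg_left hdiv hfac
        _ = Z * (4 * a * γ * C * T * Real.sqrt D + a * γ * C * Real.sqrt 2 / 2) := by ring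
    have hBrτ0 : 0 ≤ Br * τ := by positivity
    calc Br * τ ^ 2 / 2 * L = (Br * τ) * (τ / 2 * L) := by ring
      _ ≤ (Br * τ) * (Z * (c₄ * Real.sqrt D + c₅)) := mul_le_mul_of_nonneg_left hhalf hBrτ0
      _ = Br * Z * τ * (c₄ * Real.sqrt D + c₅) := by ring
  -- (III): conclude
  have hmain : T ^ 2 * D ≤ (K₁ + c₅) + c₄ * Real.sqrt D := by
    have hpos : 0 < Br * Z * τ := by positivity
    have : Br * Z * τ * (T ^ 2 * D) ≤ Br * Z * τ * ((K₁ + c₅) + c₄ * Real.sqrt D) := by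
      linarith only [hI, hA, hB]
    exact le_of_mul_le_mul_left this hpos
  exact le_of_sq_le_add_sqrt hT hD0 hmain

end Summit.AtomisticToContinuum.FouriersLaw.Theorems.OddSectorWitness.TapLeak
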